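import Summits.NavierStokesRegularity.NavierStokesRegularity.Theorems.ExtremiserTransienceRegularisedNearPlateauStabilityBangBangCoreDensitySupBound
import Literature.Analysis.Calculus.ExpNegInvGlueGevrey
import HarnessLib

/-!
# Route `ExtremiserTransience`, crux `RegularisedNearPlateauStability` (stmt-NavierStokesRegularity-28317),
# LINE g6-γ «bang-bang core»: THE LEVEL-SET CUTOFF `ζ = χ((‖v‖²/M² − a)/τ)` AND ITS DERIVATIVE BUDGET

`--supports stmt-NavierStokesRegularity-28317` (helper). Author: prover seat `ns-net-p2` (g0).

The bang-bang mechanism splits a test field along the level sets of `‖v‖²`: with Mathlib's `Real.smoothTransition = χ`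
(`χ = 0` on `(−∞,0]`, `χ = 1` on `[1,∞)`, `0 ≤ χ ≤ 1`, `C^∞`) put `ζ(y) = χ((‖v y‖²/M² − a)/τ)` (no new definition — an
explicit lambda throughout). Proved here: `ζ ∈ C^∞`; `0 ≤ ζ ≤ 1`; `ζ = 0` on `{‖v‖² ≤ aM²}`; `ζ = 1` on `{‖v‖² ≥ (a+τ)M²}`;
and the DERIVATIVE BUDGET in the A-regular class: if `‖Dʲv(x)‖ ≤ S·M·Lʲ` for `j ≤ n` then
`‖Dⁿζ(x)‖ ≤ n!·(8(n!)²256ⁿ)·(2·max(1, S²/τ)·L)ⁿ` — i.e. `≲_n (τλ)^{-n}` at `L = λ⁻¹` (Faà di Bruno bound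
`norm_iteratedFDeriv_comp_le`, the tree's Gevrey bound `norm_iteratedFDeriv_smoothTransition_le_numeral`, and the Leibniz
bound `BangBang.norm_iteratedFDeriv_inner_le_pow` for `‖v‖² = ⟪v, v⟫`).
Context: evidence note `K14-analysis.md` on items 28317 / 26567 (any level-set-split variant of the line uses this).
HONEST FRAMING: calculus only; nothing about Navier–Stokes is proved; no summit is proved by a line. [folklore]
-/

noncomputable section

open scoped InnerProductSpace RealInnerProductSpace ContDiff Nat
open Literature.Analysis.FluidPDE
open Summit.NavierStokesRegularity.NavierStokesRegularity.Theorems.DepletionLadder.KStar.HalfSpace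

namespace Summit.NavierStokesRegularity.NavierStokesRegularity.Theorems

-- the problem directory repeats the summit name (`NavierStokesRegularity/NavierStokesRegularity`)
set_option linter.dupNamespace false

namespace DepletionLadder.KStar.BangBang

variable {v : E3 → E3}

/-- The level function `y ↦ (‖v y‖²/M² − a)/τ` is `C^∞` for `v ∈ C^∞`. [folklore] -/
theorem contDiff_levelFun (hv : ContDiff ℝ ∞ v) (M a τ : ℝ) :
    ContDiff ℝ ∞ (fun y => (‖v y‖ ^ 2 / M ^ 2 - a) / τ) := by
  have h : ContDiff ℝ ∞ (fun y => ⟪v y, v y⟫_ℝ) := hv.inner ℝ hv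
  have h2 : (fun y => (‖v y‖ ^ 2 / M ^ 2 - a) / τ) = fun y => (⟪v y, v y⟫_ℝ / M ^ 2 - a) / τ := by
    funext y; rw [real_inner_self_eq_norm_sq]
  rw [h2]
  exact ((h.div_const _).sub contDiff_const).div_const _

/-- The level-set cutoff `ζ = χ((‖v‖²/M² − a)/τ)` is `C^∞`. [folklore] -/
theorem contDiff_levelCutoff (hv : ContDiff ℝ ∞ v) (M a τ : ℝ) :
    ContDiff ℝ ∞ (fun y => Real.smoothTransition ((‖v y‖ ^ 2 / M ^ 2 - a) / τ)) :=
  Real.smoothTransition.contDiff.comp (contDiff_levelFun hv M a τ)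

/-- `0 ≤ ζ ≤ 1`. [folklore] -/
theorem levelCutoff_mem_Icc (v : E3 → E3) (M a τ : ℝ) (y : E3) :
    0 ≤ Real.smoothTransition ((‖v y‖ ^ 2 / M ^ 2 - a) / τ) ∧
      Real.smoothTransition ((‖v y‖ ^ 2 / M ^ 2 - a) / τ) ≤ 1 :=
  ⟨Real.smoothTransition.nonneg _, Real.smoothTransition.le_one _⟩

/-- `ζ = 0` below the lower level: `‖v y‖² ≤ a·M²` ⇒ `ζ(y) = 0` (`τ, M > 0`). [folklore] -/
theorem levelCutoff_eq_zero {M a τ : ℝ} (hτ : 0 < τ) (hM : 0 < M) {y : E3} (hy : ‖v y‖ ^ 2 ≤ a * M ^ 2) :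
    Real.smoothTransition ((‖v y‖ ^ 2 / M ^ 2 - a) / τ) = 0 := by
  refine Real.smoothTransition.zero_of_nonpos (div_nonpos_of_nonpos_of_nonneg ?_ hτ.le)
  rw [sub_nonpos, div_le_iff₀ (by positivity)]
  exact hy

/-- `ζ = 1` above the upper level: `(a + τ)·M² ≤ ‖v y‖²` ⇒ `ζ(y) = 1` (`τ, M > 0`). [folklore] -/
theorem levelCutoff_eq_one {M a τ : ℝ} (hτ : 0 < τ) (hM : 0 < M) {y : E3} (hy : (a + τ) * M ^ 2 ≤ ‖v y‖ ^ 2) :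
    Real.smoothTransition ((‖v y‖ ^ 2 / M ^ 2 - a) / τ) = 1 := by
  refine Real.smoothTransition.one_of_one_le ?_
  rw [le_div_iff₀ hτ, one_mul, le_sub_iff_add_le, le_div_iff₀ (by positivity)]
  linarith

/-- **Derivative budget of the level-set cutoff in the A-regular class.** If `‖Dʲv(x)‖ ≤ S·M·Lʲ` for `j ≤ n`
(`L ≥ 0`, `M, τ > 0`), then `‖Dⁿζ(x)‖ ≤ n!·(8(n!)²·256ⁿ)·(2·max(1, S²/τ)·L)ⁿ` — in the application `L = λ⁻¹`, so
`‖Dⁿζ‖ ≲_n (τλ)^{-n}`. [folklore] -/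
theorem norm_iteratedFDeriv_levelCutoff_le (hv : ContDiff ℝ ∞ v) {S M L a τ : ℝ} (hτ : 0 < τ) (hM : 0 < M)
    (hL : 0 ≤ L) {x : E3} {n : ℕ} (hK : ∀ j, j ≤ n → ‖iteratedFDeriv ℝ j v x‖ ≤ S * M * L ^ j) :
    ‖iteratedFDeriv ℝ n (fun y => Real.smoothTransition ((‖v y‖ ^ 2 / M ^ 2 - a) / τ)) x‖ ≤
      (n ! : ℝ) * (8 * (n ! : ℝ) ^ 2 * 256 ^ n) * (2 * max 1 (S ^ 2 / τ) * L) ^ n := by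
  -- the inner function and its derivatives
  set f : E3 → ℝ := fun y => (‖v y‖ ^ 2 / M ^ 2 - a) / τ with hfdef
  have hf : ContDiff ℝ ∞ f := contDiff_levelFun hv M a τ
  have hg : ContDiff ℝ ∞ (fun y => ⟪v y, v y⟫_ℝ) := hv.inner ℝ hv
  have hfg : f = fun y => (M ^ 2 * τ)⁻¹ • ⟪v y, v y⟫_ℝ + -(a / τ) := by
    funext y
    rw [hfdef, smul_eq_mul, real_inner_self_eq_norm_sq]
    field_simp
    ring
  have hKb : ∀ i, i ≤ n → ‖iteratedFDeriv ℝ i v x‖ ≤ S * M * L ^ (i + 0) := fun i hi => by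
    simpa using hK i hi
  have hDg : ∀ i, i ≤ n → ‖iteratedFDeriv ℝ i (fun y => ⟪v y, v y⟫_ℝ) x‖ ≤ 2 ^ i * (S * M * (S * M) * L ^ (i + 0 + 0)) :=
    fun i hi => norm_iteratedFDeriv_inner_le_pow hv hv x (n := i) (fun j hj => hKb j (hj.trans hi))
      (fun j hj => hKb j (hj.trans hi))
  have hDf : ∀ i, 1 ≤ i → i ≤ n → ‖iteratedFDeriv ℝ i f x‖ ≤ (2 * max 1 (S ^ 2 / τ) * L) ^ i := by
    intro i hi1 hin
    have hi0 : i ≠ 0 := by omega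
    have hsplit : iteratedFDeriv ℝ i f x = (M ^ 2 * τ)⁻¹ • iteratedFDeriv ℝ i (fun y => ⟪v y, v y⟫_ℝ) x := by
      rw [hfg, fun_iteratedFDeriv_add_apply ((hg.const_smul _).contDiffAt.of_le (by exact_mod_cast le_top))
        (contDiff_const.contDiffAt.of_le (by exact_mod_cast le_top)),
        iteratedFDeriv_const_smul_apply' (hg.contDiffAt.of_le (by exact_mod_cast le_top)),
        iteratedFDeriv_const_of_ne hi0]
      simp
    rw [hsplit, norm_smul, norm_inv, Real.norm_eq_abs, abs_of_pos (by positivity)]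
    have h1 := hDg i hin
    simp only [add_zero] at h1
    have hmax : S ^ 2 / τ ≤ max 1 (S ^ 2 / τ) ^ i := by
      calc S ^ 2 / τ ≤ max 1 (S ^ 2 / τ) := le_max_right _ _
        _ = max 1 (S ^ 2 / τ) ^ 1 := (pow_one _).symm
        _ ≤ max 1 (S ^ 2 / τ) ^ i := pow_le_pow_right₀ (le_max_left _ _) hi1
    calc (M ^ 2 * τ)⁻¹ * ‖iteratedFDeriv ℝ i (fun y => ⟪v y, v y⟫_ℝ) x‖
        ≤ (M ^ 2 * τ)⁻¹ * (2 ^ i * (S * M * (S * M) * L ^ i)) := by gcongr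
      _ = S ^ 2 / τ * (2 ^ i * L ^ i) := by field_simp
      _ ≤ max 1 (S ^ 2 / τ) ^ i * (2 ^ i * L ^ i) := by gcongr
      _ = (2 * max 1 (S ^ 2 / τ) * L) ^ i := by ring
  -- the outer function `χ`
  have hC : ∀ i, i ≤ n → ‖iteratedFDeriv ℝ i Real.smoothTransition (f x)‖ ≤ 8 * (n ! : ℝ) ^ 2 * 256 ^ n := by
    intro i hi
    refine (Literature.Analysis.Calculus.norm_iteratedFDeriv_smoothTransition_le_numeral i (f x)).trans ?_
    have hfac : (i ! : ℝ) ≤ n ! := by exact_mod_cast Nat.factorial_le hi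
    gcongr
    · norm_num
  have h := norm_iteratedFDeriv_comp_le (g := Real.smoothTransition) (f := f) (n := n)
    (Real.smoothTransition.contDiff (n := ⊤)) hf (by exact_mod_cast le_top) x hC hDf
  exact h

end DepletionLadder.KStar.BangBang

end Summit.NavierStokesRegularity.NavierStokesRegularity.Theorems

end
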